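import Summits.HodgeConjecture.CorCM.Census.DicyclicTwistKeyLemma

/-!
# The dicyclic twist `Dic(A) ⊃ ℤ/2 × A`, VII: the two equator-crossing closing squares and their functional values

COR-CM (cell `pub-hodgecm2`, stage 2 of the Hodge ladder), count-neutral KERNEL COMBINATORICS by the binder seat b23 (gen 42; claim
DICYCLIC-COLUMN, HOME/INBOX.md l.10328): part VII of the lane `DicyclicTwist*`.  Theorems only (plus the evaluation shorthands `gval`, `hval`),
on top of parts I–VI and seat b09's odd slice (`ind`, `wt_ind`, `ind_add_delta_of_not_mem`, `cwt`, `Cfun_transl`); no `decide` table, no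
certificate, no named fact, no geometry, no `sorry`.  `Interfaces.lean` (C1), every E term, B01, `Transposition/*`, `PortJoin/*` untouched.
HONEST FRAMING: `HC_CM` is NOT proved, here or anywhere in the tree; nothing here is a period, a count of record or a headline.

CONTENT (`|A| = 2K + 1 ≥ 3`).  The CLOSING SQUARES of the lane are the `1`-coordinate squares over the passive constant label `0`
  `f₁ = faceVec₁ 0 (𝟙_P) u u′` (`|P| = K − 1`, `u ≠ u′ ∉ P`; corner weights `K−1, K, K, K+1`) and
  `f₂ = faceVec₁ 0 (𝟙_{P ∪ u}) u′ u″` (`u″ ∉ P ∪ {u, u′}`; corner weights `K, K+1, K+1, K+2`, b09's closing shape),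
both of which CROSS the weight equator — so the functionals of part IV do not vanish on them.  §1 evaluates `U s`, `U' s`, `C₀`, `C₁` on a
`1`-coordinate square over `0` and on a `0`-coordinate square over `1` (the shape of the `x`-translates) in terms of the half and defect
indicators of indicator types (`U_faceVec₁_zero`, `U'_faceVec₀_one`, `C₁_faceVec₁`, `C₀_faceVec₀`, …); §2 specialises:
  **`U s (f₁ + f₂) = −[s = u′]`**, `C₁ (f₁ + f₂) = 0`, `U s f₁ = [s ∉ P ∪ {u,u′}]`, `C₁ f₁ = −|A|`, `U' = C₀ = 0` on both, and the mirror
  statements for the `0`-coordinate squares over `1`: `U' s (f₁ˣ + f₂ˣ) = [s = u′]`, `C₀ f₁ˣ = −|A|`, `U = C₁ = 0`.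
§3: translation by `(0, v)` shifts `U s`, `U' s` to `U (s+v)`, `U' (s+v)` and fixes `C₀`, `C₁` (`U_translH_zero`, …).  Part VIII turns
these values into generators with prescribed functionals and proves the generation theorem.  All [folklore].

## References
* [Pohlmann1968] H. Pohlmann, Algebraic cycles on abelian varieties of complex multiplication type, Ann. of Math. 88 (1968), Thm 1.
-/

namespace Summit.HodgeConjecture.CorCM.Census.DicyclicTwist

open Finset
open Summit.HodgeConjecture.CorCM.Census.OddSliceFacesModel
open Summit.HodgeConjecture.CorCM.Census.OddSliceFacesSquares
open Summit.HodgeConjecture.CorCM.Census.OddSliceFacesDescent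
open Summit.HodgeConjecture.CorCM.Census.EvenSliceFacesDescent
open Summit.HodgeConjecture.CorCM.Census.OddSliceFacesGenerate

variable (A : Type) [AddCommGroup A] [Fintype A] [DecidableEq A]

/-! ## §1 Functionals of squares over a constant passive label -/

/-- The `U s`-value of the label `(0, b)`: `[b up]·[b s = 0]`. [folklore] -/
def gval (s : A) (b : Ty A) : ℤ := (1 - lowI A b) * (1 - dft A s b)

/-- The mirror value of the label `(a, 1)` read through `U' s`: `[a low]·[a s = 1]`. [folklore] -/
def hval (s : A) (a : Ty A) : ℤ := lowI A a * dft A s a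

omit [AddCommGroup A] [Fintype A] [DecidableEq A] in
/-- `1 + 1 = 0` on labels. [folklore] -/
theorem one_add_one_ty : (1 : Ty A) + 1 = 0 := by
  funext s; exact (by decide : (1 : ZMod 2) + 1 = 0)

omit [AddCommGroup A] [DecidableEq A] in
/-- `uwt s (0, b) = gval s b`. [folklore] -/
theorem uwt_zero_left (s : A) (b : Ty A) : uwt A s (0, b) = gval A s b := by
  have l0 : lowI A (0 : Ty A) = 1 := by simp [lowI, isLow_zero]
  unfold uwt gval; simp only [l0]; ring

omit [AddCommGroup A] [DecidableEq A] in
/-- `uwt s (1, a) = −hval s a` (`|A| ≥ 1`). [folklore] -/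
theorem uwt_one_left (h1 : 1 ≤ Fintype.card A) (s : A) (a : Ty A) : uwt A s (1, a) = -hval A s a := by
  have l1 : lowI A (1 : Ty A) = 0 := by simp [lowI, not_isLow_one A h1]
  unfold uwt hval; simp only [l1]; ring

omit [AddCommGroup A] [DecidableEq A] in
/-- `uwt s (b, 0) = 0`. [folklore] -/
theorem uwt_zero_right (s : A) (b : Ty A) : uwt A s (b, 0) = 0 := by
  have l0 : lowI A (0 : Ty A) = 1 := by simp [lowI, isLow_zero]
  unfold uwt; simp only [l0, dft_zero]; ring

omit [AddCommGroup A] [DecidableEq A] in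
/-- `uwt s (b, 1) = 0` (`|A| ≥ 1`). [folklore] -/
theorem uwt_one_right (h1 : 1 ≤ Fintype.card A) (s : A) (b : Ty A) : uwt A s (b, 1) = 0 := by
  have l1 : lowI A (1 : Ty A) = 0 := by simp [lowI, not_isLow_one A h1]
  unfold uwt; simp only [l1, dft_one]; ring

omit [AddCommGroup A] in
/-- **`U s` of a `1`-coordinate square over `0`** is the alternating sum of `gval`. [folklore] -/
theorem U_faceVec₁_zero (hA : Odd (Fintype.card A)) (s : A) (φ : Ty A) (i j : A) :
    U A s (faceVec₁ A 0 φ i j) = gval A s φ - gval A s (φ + δ A i) - gval A s (φ + δ A j) + gval A s (φ + δ A i + δ A j) := by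
  rw [faceVec₁, map_add, map_add, map_add, U_single, U_single, U_single, U_single, add_right_comm φ 1 (δ A i),
    add_right_comm φ 1 (δ A j), uwt_conj A hA, uwt_conj A hA, uwt_zero_left, uwt_zero_left, uwt_zero_left, uwt_zero_left]
  ring

omit [AddCommGroup A] in
/-- `U' s` vanishes on a `1`-coordinate square over `0`. [folklore] -/
theorem U'_faceVec₁_zero (hA : Odd (Fintype.card A)) (s : A) (φ : Ty A) (i j : A) : U' A s (faceVec₁ A 0 φ i j) = 0 := by
  have h1 : 1 ≤ Fintype.card A := Odd.pos hA
  rw [faceVec₁, map_add, map_add, map_add, U'_single, U'_single, U'_single, U'_single]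
  simp only [zero_add]
  rw [uwt_zero_right, uwt_zero_right, uwt_one_right A h1, uwt_one_right A h1]; ring

omit [AddCommGroup A] in
/-- `C₀` vanishes on a `1`-coordinate square. [folklore] -/
theorem C₀_faceVec₁ (hA : Odd (Fintype.card A)) (ψ φ : Ty A) (i j : A) : C₀ A (faceVec₁ A ψ φ i j) = 0 := by
  rw [C₀_apply, marg₀_faceVec₁, Cfun_two_smul_pairVec A hA]

omit [AddCommGroup A] in
/-- **`C₁` of a `1`-coordinate square** is the alternating signed weight of the active corners. [folklore] -/
theorem C₁_faceVec₁ (hA : Odd (Fintype.card A)) (ψ φ : Ty A) (i j : A) :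
    C₁ A (faceVec₁ A ψ φ i j) = cwt A φ - cwt A (φ + δ A i) - cwt A (φ + δ A j) + cwt A (φ + δ A i + δ A j) := by
  rw [C₁_apply, marg₁_faceVec₁, Cfun_faceVec_eq A hA]

omit [AddCommGroup A] in
/-- **`U' s` of a `0`-coordinate square over `1`** is the alternating sum of `hval` (signs reversed). [folklore] -/
theorem U'_faceVec₀_one (hA : Odd (Fintype.card A)) (s : A) (φ : Ty A) (i j : A) :
    U' A s (faceVec₀ A φ i j 1) = -hval A s φ + hval A s (φ + δ A i) + hval A s (φ + δ A j) - hval A s (φ + δ A i + δ A j) := by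
  have h1 : 1 ≤ Fintype.card A := Odd.pos hA
  have c : ∀ a : Ty A, uwt A s (0, a + 1) = hval A s a := fun a => by
    have := uwt_conj A hA s 1 a
    rw [one_add_one_ty] at this
    rw [this, uwt_one_left A h1]; ring
  rw [faceVec₀, map_add, map_add, map_add, U'_single, U'_single, U'_single, U'_single]
  simp only
  rw [add_right_comm φ 1 (δ A i), add_right_comm φ 1 (δ A j), one_add_one_ty, uwt_one_left A h1, uwt_one_left A h1, c, c]
  ring

omit [AddCommGroup A] in
/-- `U s` vanishes on a `0`-coordinate square over `1`. [folklore] -/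
theorem U_faceVec₀_one (hA : Odd (Fintype.card A)) (s : A) (φ : Ty A) (i j : A) : U A s (faceVec₀ A φ i j 1) = 0 := by
  have h1 : 1 ≤ Fintype.card A := Odd.pos hA
  rw [faceVec₀, map_add, map_add, map_add, U_single, U_single, U_single, U_single, one_add_one_ty]
  have z1 : ∀ a : Ty A, uwt A s (a, 1) = 0 := fun a => by
    have l1 : lowI A (1 : Ty A) = 0 := by simp [lowI, not_isLow_one A h1]
    unfold uwt; simp only [l1, dft_one]; ring
  have z0 : ∀ a : Ty A, uwt A s (a, 0) = 0 := fun a => by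
    have l0 : lowI A (0 : Ty A) = 1 := by simp [lowI, isLow_zero]
    unfold uwt; simp only [l0, dft_zero]; ring
  rw [z1, z1, z0, z0]; ring

omit [AddCommGroup A] in
/-- `C₁` vanishes on a `0`-coordinate square. [folklore] -/
theorem C₁_faceVec₀ (hA : Odd (Fintype.card A)) (φ : Ty A) (i j : A) (ψ : Ty A) : C₁ A (faceVec₀ A φ i j ψ) = 0 := by
  rw [C₁_apply, marg₁_faceVec₀, Cfun_two_smul_pairVec A hA]

omit [AddCommGroup A] in
/-- **`C₀` of a `0`-coordinate square** is the alternating signed weight of the active corners. [folklore] -/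
theorem C₀_faceVec₀ (hA : Odd (Fintype.card A)) (φ : Ty A) (i j : A) (ψ : Ty A) :
    C₀ A (faceVec₀ A φ i j ψ) = cwt A φ - cwt A (φ + δ A i) - cwt A (φ + δ A j) + cwt A (φ + δ A i + δ A j) := by
  rw [C₀_apply, marg₀_faceVec₀, Cfun_faceVec_eq A hA]

/-! ## §2 Indicator types: the closing squares -/

omit [AddCommGroup A] in
/-- The half indicator of an indicator type. [folklore] -/
theorem lowI_ind (Q : Finset A) : lowI A (ind A Q) = if Q.card ≤ Fintype.card A / 2 then 1 else 0 := by
  unfold lowI; rw [wt_ind]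

omit [AddCommGroup A] [Fintype A] in
/-- The defect indicator of an indicator type. [folklore] -/
theorem dft_ind (s : A) (Q : Finset A) : dft A s (ind A Q) = if s ∈ Q then 1 else 0 := by
  unfold dft ind
  by_cases h : s ∈ Q
  · simp [h]
  · simp [h]

omit [AddCommGroup A] in
/-- The signed weight of an indicator type. [folklore] -/
theorem cwt_ind (Q : Finset A) :
    cwt A (ind A Q) = if Q.card ≤ Fintype.card A / 2 then (Q.card : ℤ) else (Q.card : ℤ) - Fintype.card A := by
  unfold cwt; rw [wt_ind]

omit [AddCommGroup A] in
/-- `gval` of an indicator type: `[|Q| > K]·[s ∉ Q]`. [folklore] -/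
theorem gval_ind (s : A) (Q : Finset A) :
    gval A s (ind A Q) = (if Q.card ≤ Fintype.card A / 2 then 0 else 1) * (if s ∈ Q then 0 else 1) := by
  unfold gval; rw [lowI_ind, dft_ind]; split_ifs <;> ring

omit [AddCommGroup A] in
/-- `hval` of an indicator type: `[|Q| ≤ K]·[s ∈ Q]`. [folklore] -/
theorem hval_ind (s : A) (Q : Finset A) :
    hval A s (ind A Q) = (if Q.card ≤ Fintype.card A / 2 then 1 else 0) * (if s ∈ Q then 1 else 0) := by
  unfold hval; rw [lowI_ind, dft_ind]

section Closing

variable {A}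

omit [AddCommGroup A] [Fintype A] in
/-- The corners of `f₁ = (0 | 𝟙_P; u, u′)` as indicator types. [folklore] -/
theorem corners₁ {P : Finset A} {u u' : A} (hu : u ∉ P) (hu' : u' ∉ P) (huu' : u ≠ u') : ind A P + δ A u = ind A (insert u P) ∧ ind A P + δ A u' = ind A (insert u' P) ∧
    ind A P + δ A u + δ A u' = ind A (insert u' (insert u P)) := by
  refine ⟨ind_add_delta_of_not_mem A hu, ind_add_delta_of_not_mem A hu', ?_⟩
  rw [ind_add_delta_of_not_mem A hu, ind_add_delta_of_not_mem A (by simp [huu'.symm, hu'])]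

omit [AddCommGroup A] [Fintype A] in
/-- The corners of `f₂ = (0 | 𝟙_{P ∪ u}; u′, u″)` as indicator types. [folklore] -/
theorem corners₂ {P : Finset A} {u u' u'' : A} (hu' : u' ∉ P) (hu'' : u'' ∉ P) (huu' : u ≠ u') (huu'' : u ≠ u'') (hu'u'' : u' ≠ u'') : ind A (insert u P) + δ A u' = ind A (insert u' (insert u P)) ∧
    ind A (insert u P) + δ A u'' = ind A (insert u'' (insert u P)) ∧
    ind A (insert u P) + δ A u' + δ A u'' = ind A (insert u'' (insert u' (insert u P))) := by
  have h1 : u' ∉ insert u P := by simp [huu'.symm, hu']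
  have h2 : u'' ∉ insert u P := by simp [huu''.symm, hu'']
  have h3 : u'' ∉ insert u' (insert u P) := by simp [hu'u''.symm, huu''.symm, hu'']
  refine ⟨ind_add_delta_of_not_mem A h1, ind_add_delta_of_not_mem A h2, ?_⟩
  rw [ind_add_delta_of_not_mem A h1, ind_add_delta_of_not_mem A h3]

omit [AddCommGroup A] [Fintype A] in
/-- Cardinalities of the corner sets. [folklore] -/
theorem cards {P : Finset A} {u u' u'' : A} (hu : u ∉ P) (hu' : u' ∉ P) (hu'' : u'' ∉ P) (huu' : u ≠ u') (huu'' : u ≠ u'')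
    (hu'u'' : u' ≠ u'') : (insert u P).card = P.card + 1 ∧ (insert u' P).card = P.card + 1 ∧ (insert u' (insert u P)).card = P.card + 2 ∧
    (insert u'' (insert u P)).card = P.card + 2 ∧ (insert u'' (insert u' (insert u P))).card = P.card + 3 := by
  have h1 : u' ∉ insert u P := by simp [huu'.symm, hu']
  have h2 : u'' ∉ insert u P := by simp [huu''.symm, hu'']
  have h3 : u'' ∉ insert u' (insert u P) := by simp [hu'u''.symm, huu''.symm, hu'']
  refine ⟨Finset.card_insert_of_notMem hu, Finset.card_insert_of_notMem hu', ?_, ?_, ?_⟩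
  · rw [Finset.card_insert_of_notMem h1, Finset.card_insert_of_notMem hu]
  · rw [Finset.card_insert_of_notMem h2, Finset.card_insert_of_notMem hu]
  · rw [Finset.card_insert_of_notMem h3, Finset.card_insert_of_notMem h1, Finset.card_insert_of_notMem hu]

omit [AddCommGroup A] in
/-- **`U s (f₁ + f₂) = −[s = u′]`.** [folklore] -/
theorem U_closing (hA : Odd (Fintype.card A)) {P : Finset A} {u u' u'' : A} (hP : P.card + 1 = Fintype.card A / 2)
    (hu : u ∉ P) (hu' : u' ∉ P) (hu'' : u'' ∉ P) (huu' : u ≠ u') (huu'' : u ≠ u'') (hu'u'' : u' ≠ u'') (s : A) :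
    U A s (faceVec₁ A 0 (ind A P) u u' + faceVec₁ A 0 (ind A (insert u P)) u' u'') = if s = u' then -1 else 0 := by
  obtain ⟨c1, c2, c3⟩ := corners₁ hu hu' huu'
  obtain ⟨d1, d2, d3⟩ := corners₂ hu' hu'' huu' huu'' hu'u''
  obtain ⟨k1, k2, k3, k4, k5⟩ := cards hu hu' hu'' huu' huu'' hu'u''
  rw [map_add, U_faceVec₁_zero A hA, U_faceVec₁_zero A hA, c3, c1, c2, d3, d1, d2]
  simp only [gval_ind, k1, k2, k3, k4, k5, Finset.mem_insert]
  have e1 : P.card ≤ Fintype.card A / 2 := by omega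
  have e2 : P.card + 1 ≤ Fintype.card A / 2 := by omega
  have e3 : ¬ (P.card + 2 ≤ Fintype.card A / 2) := by omega
  have e4 : ¬ (P.card + 3 ≤ Fintype.card A / 2) := by omega
  simp only [e1, e2, e3, e4, ↓reduceIte, zero_mul, one_mul, sub_zero, zero_sub, zero_add]
  by_cases hs : s = u'
  · subst hs; simp [huu'.symm, hu'u'', hu']
  · by_cases hs2 : s = u''
    · subst hs2; simp [hs, huu''.symm, hu'']
    · by_cases hs3 : s = u
      · subst hs3; simp [hs, hs2]
      · by_cases hs4 : s ∈ P
        · simp [hs, hs2, hs3, hs4]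
        · simp [hs, hs2, hs3, hs4]

omit [AddCommGroup A] in
/-- **`U s f₁ = [s ∉ P ∪ {u, u′}]`.** [folklore] -/
theorem U_f₁ (hA : Odd (Fintype.card A)) {P : Finset A} {u u' u'' : A} (hP : P.card + 1 = Fintype.card A / 2)
    (hu : u ∉ P) (hu' : u' ∉ P) (hu'' : u'' ∉ P) (huu' : u ≠ u') (huu'' : u ≠ u'') (hu'u'' : u' ≠ u'') (s : A) : U A s (faceVec₁ A 0 (ind A P) u u') = if s = u' ∨ s = u ∨ s ∈ P then 0 else 1 := by
  obtain ⟨c1, c2, c3⟩ := corners₁ hu hu' huu'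
  obtain ⟨k1, k2, k3, k4, k5⟩ := cards hu hu' hu'' huu' huu'' hu'u''
  rw [U_faceVec₁_zero A hA, c3, c1, c2]
  simp only [gval_ind, k1, k2, k3, Finset.mem_insert]
  have e1 : P.card ≤ Fintype.card A / 2 := by omega
  have e2 : P.card + 1 ≤ Fintype.card A / 2 := by omega
  have e3 : ¬ (P.card + 2 ≤ Fintype.card A / 2) := by omega
  simp only [e1, e2, e3, ↓reduceIte, zero_mul, one_mul, sub_zero, zero_add]

omit [AddCommGroup A] in
/-- **`C₁ f₁ = −|A|`, `C₁ f₂ = |A|`.** [folklore] -/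
theorem C₁_closing (hA : Odd (Fintype.card A)) {P : Finset A} {u u' u'' : A} (hP : P.card + 1 = Fintype.card A / 2)
    (hu : u ∉ P) (hu' : u' ∉ P) (hu'' : u'' ∉ P) (huu' : u ≠ u') (huu'' : u ≠ u'') (hu'u'' : u' ≠ u'') : C₁ A (faceVec₁ A 0 (ind A P) u u') = -(Fintype.card A : ℤ) ∧
    C₁ A (faceVec₁ A 0 (ind A (insert u P)) u' u'') = Fintype.card A := by
  have hodd : Fintype.card A % 2 = 1 := Nat.odd_iff.mp hA
  obtain ⟨c1, c2, c3⟩ := corners₁ hu hu' huu'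
  obtain ⟨d1, d2, d3⟩ := corners₂ hu' hu'' huu' huu'' hu'u''
  obtain ⟨k1, k2, k3, k4, k5⟩ := cards hu hu' hu'' huu' huu'' hu'u''
  have e1 : P.card ≤ Fintype.card A / 2 := by omega
  have e2 : P.card + 1 ≤ Fintype.card A / 2 := by omega
  have e3 : ¬ (P.card + 2 ≤ Fintype.card A / 2) := by omega
  have e4 : ¬ (P.card + 3 ≤ Fintype.card A / 2) := by omega
  have hK : (Fintype.card A : ℤ) = 2 * (P.card : ℤ) + 3 := by
    have : Fintype.card A = 2 * (P.card + 1) + 1 := by omega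
    rw [this]; push_cast; ring
  constructor
  · rw [C₁_faceVec₁ A hA, c3, c1, c2]
    simp only [cwt_ind, k1, k2, k3, e1, e2, e3, ↓reduceIte]
    push_cast; rw [hK]; ring
  · rw [C₁_faceVec₁ A hA, d3, d1, d2]
    simp only [cwt_ind, k1, k3, k4, k5, e2, e3, e4, ↓reduceIte]
    push_cast; rw [hK]; ring

omit [AddCommGroup A] in
/-- `U'` and `C₀` vanish on `f₁`, `f₂`. [folklore] -/
theorem U'_C₀_closing (hA : Odd (Fintype.card A)) {P : Finset A} {u u' u'' : A} (s : A) : U' A s (faceVec₁ A 0 (ind A P) u u') = 0 ∧ U' A s (faceVec₁ A 0 (ind A (insert u P)) u' u'') = 0 ∧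
    C₀ A (faceVec₁ A 0 (ind A P) u u') = 0 ∧ C₀ A (faceVec₁ A 0 (ind A (insert u P)) u' u'') = 0 :=
  ⟨U'_faceVec₁_zero A hA s _ _ _, U'_faceVec₁_zero A hA s _ _ _, C₀_faceVec₁ A hA _ _ _ _, C₀_faceVec₁ A hA _ _ _ _⟩

omit [AddCommGroup A] in
/-- **Mirror: `U' s (f₁ˣ + f₂ˣ) = [s = u′]`** for the `0`-coordinate squares over `1` with the same data. [folklore] -/
theorem U'_closing (hA : Odd (Fintype.card A)) {P : Finset A} {u u' u'' : A} (hP : P.card + 1 = Fintype.card A / 2)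
    (hu : u ∉ P) (hu' : u' ∉ P) (hu'' : u'' ∉ P) (huu' : u ≠ u') (huu'' : u ≠ u'') (hu'u'' : u' ≠ u'') (s : A) :
    U' A s (faceVec₀ A (ind A P) u u' 1 + faceVec₀ A (ind A (insert u P)) u' u'' 1) = if s = u' then 1 else 0 := by
  obtain ⟨c1, c2, c3⟩ := corners₁ hu hu' huu'
  obtain ⟨d1, d2, d3⟩ := corners₂ hu' hu'' huu' huu'' hu'u''
  obtain ⟨k1, k2, k3, k4, k5⟩ := cards hu hu' hu'' huu' huu'' hu'u''
  rw [map_add, U'_faceVec₀_one A hA, U'_faceVec₀_one A hA, c3, c1, c2, d3, d1, d2]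
  simp only [hval_ind, k1, k2, k3, k4, k5, Finset.mem_insert]
  have e1 : P.card ≤ Fintype.card A / 2 := by omega
  have e2 : P.card + 1 ≤ Fintype.card A / 2 := by omega
  have e3 : ¬ (P.card + 2 ≤ Fintype.card A / 2) := by omega
  have e4 : ¬ (P.card + 3 ≤ Fintype.card A / 2) := by omega
  simp only [e1, e2, e3, e4, ↓reduceIte, zero_mul, one_mul, sub_zero, add_zero]
  by_cases hs : s = u'
  · subst hs; simp [huu'.symm, hu']
  · by_cases hs3 : s = u
    · subst hs3; simp [hs, hu]
    · by_cases hs4 : s ∈ P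
      · simp [hs, hs3, hs4]
      · simp [hs, hs3, hs4]

omit [AddCommGroup A] in
/-- **Mirror: `U' s f₁ˣ = [s ∈ P ∪ {u, u′}]`.** [folklore] -/
theorem U'_f₁x (hA : Odd (Fintype.card A)) {P : Finset A} {u u' u'' : A} (hP : P.card + 1 = Fintype.card A / 2)
    (hu : u ∉ P) (hu' : u' ∉ P) (hu'' : u'' ∉ P) (huu' : u ≠ u') (huu'' : u ≠ u'') (hu'u'' : u' ≠ u'') (s : A) : U' A s (faceVec₀ A (ind A P) u u' 1) = if s = u' ∨ s = u ∨ s ∈ P then 1 else 0 := by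
  obtain ⟨c1, c2, c3⟩ := corners₁ hu hu' huu'
  obtain ⟨k1, k2, k3, k4, k5⟩ := cards hu hu' hu'' huu' huu'' hu'u''
  rw [U'_faceVec₀_one A hA, c3, c1, c2]
  simp only [hval_ind, k1, k2, k3, Finset.mem_insert]
  have e1 : P.card ≤ Fintype.card A / 2 := by omega
  have e2 : P.card + 1 ≤ Fintype.card A / 2 := by omega
  have e3 : ¬ (P.card + 2 ≤ Fintype.card A / 2) := by omega
  simp only [e1, e2, e3, ↓reduceIte, zero_mul, one_mul, sub_zero]
  by_cases hs : s = u'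
  · subst hs; simp [huu'.symm, hu']
  · by_cases hs3 : s = u
    · subst hs3; simp [hs, hu]
    · by_cases hs4 : s ∈ P
      · simp [hs, hs3, hs4]
      · simp [hs, hs3, hs4]

omit [AddCommGroup A] in
/-- **Mirror: `C₀ f₁ˣ = −|A|`, `C₀ f₂ˣ = |A|`, and `U`, `C₁` vanish on `f₁ˣ`, `f₂ˣ`.** [folklore] -/
theorem C₀_closing (hA : Odd (Fintype.card A)) {P : Finset A} {u u' u'' : A} (hP : P.card + 1 = Fintype.card A / 2)
    (hu : u ∉ P) (hu' : u' ∉ P) (hu'' : u'' ∉ P) (huu' : u ≠ u') (huu'' : u ≠ u'') (hu'u'' : u' ≠ u'') (s : A) : C₀ A (faceVec₀ A (ind A P) u u' 1) = -(Fintype.card A : ℤ) ∧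
    C₀ A (faceVec₀ A (ind A (insert u P)) u' u'' 1) = Fintype.card A ∧
    U A s (faceVec₀ A (ind A P) u u' 1) = 0 ∧ U A s (faceVec₀ A (ind A (insert u P)) u' u'' 1) = 0 ∧
    C₁ A (faceVec₀ A (ind A P) u u' 1) = 0 ∧ C₁ A (faceVec₀ A (ind A (insert u P)) u' u'' 1) = 0 := by
  have hodd : Fintype.card A % 2 = 1 := Nat.odd_iff.mp hA
  obtain ⟨c1, c2, c3⟩ := corners₁ hu hu' huu'
  obtain ⟨d1, d2, d3⟩ := corners₂ hu' hu'' huu' huu'' hu'u''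
  obtain ⟨k1, k2, k3, k4, k5⟩ := cards hu hu' hu'' huu' huu'' hu'u''
  have e1 : P.card ≤ Fintype.card A / 2 := by omega
  have e2 : P.card + 1 ≤ Fintype.card A / 2 := by omega
  have e3 : ¬ (P.card + 2 ≤ Fintype.card A / 2) := by omega
  have e4 : ¬ (P.card + 3 ≤ Fintype.card A / 2) := by omega
  have hK : (Fintype.card A : ℤ) = 2 * (P.card : ℤ) + 3 := by
    have : Fintype.card A = 2 * (P.card + 1) + 1 := by omega
    rw [this]; push_cast; ring
  refine ⟨?_, ?_, U_faceVec₀_one A hA s _ _ _, U_faceVec₀_one A hA s _ _ _, C₁_faceVec₀ A hA _ _ _ _, C₁_faceVec₀ A hA _ _ _ _⟩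
  · rw [C₀_faceVec₀ A hA, c3, c1, c2]
    simp only [cwt_ind, k1, k2, k3, e1, e2, e3, ↓reduceIte]
    push_cast; rw [hK]; ring
  · rw [C₀_faceVec₀ A hA, d3, d1, d2]
    simp only [cwt_ind, k1, k3, k4, k5, e2, e3, e4, ↓reduceIte]
    push_cast; rw [hK]; ring

end Closing

/-! ## §3 Translation by `(0, v)` shifts `U`, `U'` and fixes `C₀`, `C₁` -/

omit [DecidableEq A] in
/-- The half indicator is invariant under `(0,v)`-twists. [folklore] -/
theorem lowI_tw_zero (v : A) (b : Ty A) : lowI A (tw A (0, v) b) = lowI A b := by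
  unfold lowI; rw [wt_tw_zero]

omit [Fintype A] [DecidableEq A] in
/-- The defect indicator of a `(0,v)`-twist: `dft s (tw (0,v) b) = dft (s + v) b`. [folklore] -/
theorem dft_tw_zero (s v : A) (b : Ty A) : dft A s (tw A (0, v) b) = dft A (s + v) b := by
  unfold dft tw; simp

omit [DecidableEq A] in
/-- The weight of `U s` after a `(0,v)`-twist of the label. [folklore] -/
theorem uwt_twH_zero (s v : A) (Ψ : Ty₂ A) : uwt A s (twH A (0, v) Ψ) = uwt A (s + v) Ψ := by
  unfold uwt twH; simp only [lowI_tw_zero, dft_tw_zero]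

/-- **`U s (translH (0,v) w) = U (s + v) w`.** [folklore] -/
theorem U_translH_zero (s v : A) (w : Ty₂ A → ℤ) : U A s (translH A (0, v) w) = U A (s + v) w := by
  show uwt A s ⬝ᵥ translH A (0, v) w = uwt A (s + v) ⬝ᵥ w
  have e : translH A (0, v) w = w ∘ (twHEquiv A (0, v)).symm := rfl
  rw [e, dotProduct_comp_equiv_symm]
  congr 1
  funext Ψ
  exact uwt_twH_zero A s v Ψ

/-- **`U' s (translH (0,v) w) = U' (s + v) w`.** [folklore] -/
theorem U'_translH_zero (s v : A) (w : Ty₂ A → ℤ) : U' A s (translH A (0, v) w) = U' A (s + v) w := by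
  show (fun Ψ : Ty₂ A => uwt A s (Ψ.2, Ψ.1)) ⬝ᵥ translH A (0, v) w = (fun Ψ : Ty₂ A => uwt A (s + v) (Ψ.2, Ψ.1)) ⬝ᵥ w
  have e : translH A (0, v) w = w ∘ (twHEquiv A (0, v)).symm := rfl
  rw [e, dotProduct_comp_equiv_symm]
  congr 1
  funext Ψ
  show uwt A s ((twH A (0, v) Ψ).2, (twH A (0, v) Ψ).1) = uwt A (s + v) (Ψ.2, Ψ.1)
  have : ((twH A (0, v) Ψ).2, (twH A (0, v) Ψ).1) = twH A (0, v) (Ψ.2, Ψ.1) := rfl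
  rw [this, uwt_twH_zero]

/-- **`C₁` is invariant under `(0,v)`-translation.** [folklore] -/
theorem C₁_translH_zero (hA : Odd (Fintype.card A)) (v : A) (w : Ty₂ A → ℤ) : C₁ A (translH A (0, v) w) = C₁ A w := by
  rw [C₁_apply, C₁_apply, marg₁_translH, Cfun_transl A hA]; simp

/-- **`C₀` is invariant under `(0,v)`-translation.** [folklore] -/
theorem C₀_translH_zero (hA : Odd (Fintype.card A)) (v : A) (w : Ty₂ A → ℤ) : C₀ A (translH A (0, v) w) = C₀ A w := by
  rw [C₀_apply, C₀_apply, marg₀_translH, Cfun_transl A hA]; simp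

end Summit.HodgeConjecture.CorCM.Census.DicyclicTwist
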